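import Mathlib.SetTheory.Cardinal.Arithmetic
import Literature.ModelTheory.Quasiminimal.PartialEmbeddings
import Literature.ModelTheory.Quasiminimal.PregeometryMatroid
import HarnessLib

/-!
# Quasiminimal pregeometry classes (Haykazyan 2016, Def. 2) and categoricity in power

L. Haykazyan, *Categoricity in quasiminimal pregeometry classes*, J. Symbolic Logic 81 (2016)
56–64, isolates (Def. 2, following B. Zilber 2005 and J. Kirby, *On quasiminimal excellent
classes*, J. Symbolic Logic 75 (2010), Def. 1.1, axioms 0, I, II) the notion of a
**quasiminimal pregeometry class**: a class `𝒞` of pairs `⟨H, cl_H⟩` of an `L`-structure and a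
pregeometry with the countable closure property, closed under isomorphism, all satisfying the same
quantifier-free sentences, containing the closed subsets of its members, in which the closure is
determined by partial embeddings, and which is `ℵ₀`-homogeneous over countable closed models (or
`∅`) ACROSS any two members. His Theorem 16 (a direct proof of Zilber's categoricity theorem,
avoiding Shelah's excellence, shown redundant by Bays–Hart–Hyttinen–Kesälä–Kirby 2014): for
`H, H' ∈ 𝒞` uncountable with bases `B, B'`, every bijection `B → B'` extends to an isomorphism
`H ≅ H'`; in particular `𝒞` is categorical in every uncountable cardinal.

The files `PregeometryStructures.lean`, `PartialEmbeddings.lean`, `CountableModels.lean`, … of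
this directory formalise the ONE-structure theory (BHHKK 2014's quasiminimal pregeometry
*structures*: quantifier-free types `L.EqQFType x y` of tuples of the same structure, partial
embeddings `IsQFEmbOn L f A` of a structure into itself). Categoricity compares two structures, so
this file sets up the two-structure ("heterogeneous") versions and the class notion:

* `FirstOrder.Language.EqQFType₂ L x y` — the tuples `x : α → M`, `y : α → N` (two
  `L`-structures) satisfy the same atomic, equivalently quantifier-free, formulas; for `M = N` this
  is `L.EqQFType x y` by `Iff.rfl` (`eqQFType₂_iff_eqQFType`).
* `Literature.ModelTheory.Quasiminimal.IsPartialEmbOn L f A` — the map `f : M → N` restricted to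
  `A ⊆ M` is a partial embedding (Haykazyan §2: a partial map preserving quantifier-free
  formulas; equivalently all finite tuples from `A` keep their quantifier-free type); for `M = N`
  this is `IsQFEmbOn L f A` by `Iff.rfl`.
* `FirstOrder.Language.EqQFTypeOver₂ L G g t t'` — "`g ∪ (t ↦ t')` is a partial embedding on
  `G ∪ range t`" (heterogeneous `EqQFTypeOver`).
* `Literature.ModelTheory.Quasiminimal.IsQuasiminimalPregeometryClass L 𝒞` — Haykazyan's
  Def. 2, for a class `𝒞` of `L`-structures-with-closure on types of one universe, rendered as a
  predicate `𝒞 : ∀ (H : Type u) [L.Structure H], (Set H → Set H) → Prop`.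
* Proved: bases of the pregeometry of a member exist (`IsPregeometry.exists_clBase`), an
  uncountable member has the cardinality of any spanning set, in particular of any basis
  (`IsPregeometry.mk_eq_mk_of_cl_eq_univ`, from the countable closure property and finite
  character), and hence **categoricity in uncountable powers follows from Theorem 16**
  (`IsQuasiminimalPregeometryClass.nonempty_equiv_of_mk_eq`: with the conclusion of Haykazyan's
  Thm 16 as a hypothesis, two uncountable members of the same cardinality are isomorphic).
  Theorem 16 itself is NOT asserted here (no named fact is introduced in this file).
* Proved, for later use on both halves of the categoricity proofs: the countable back-and-forth
  engine across two structures (`exists_map_of_backAndForth₂`), the closure transported along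
  matched tuples (`mem_cl_iff_of_eqQFType₂_snoc`, `mem_cl_of_eqQFTypeOver₂_snoc`), and
  Haykazyan's Prop. 5: `g ∪ f` extends to an isomorphism `cl(G ∪ X) ≅ cl(G' ∪ X')`
  (`exists_isPartialEmbOn_cl_extend`) and generic points can be matched over it
  (`eqQFTypeOver₂_snoc_of_notMem_cl`); in a class with an empty member all `cl ∅` are empty
  (`cl_empty_eq_empty_of_isEmpty`).

## Design

* A class is a `Prop`-valued predicate on (type, structure instance, closure operator); "pairs
  `⟨H, cl_H⟩`" of the source. All members live in one universe `u` (the application, Zilber's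
  exponential fields, has `u = 0`); the language is arbitrary (`Language.{v, w}`; Haykazyan's `L`
  is any finitary language, no countability assumed, Def. 2 and §2).
* Partial maps are total functions together with the subset on which they are meant, as in
  `PartialEmbeddings.lean`; an "isomorphism `g : G → G'`" between countable closed subsets is a
  map `g : H → H'` with `IsPartialEmbOn L g G` and `G' = g '' G` (a partial embedding is
  injective on its set and an isomorphism of the induced substructures onto its image).
* "`x` independent from `G`" (`G` closed or empty) is `x ∉ cl G`; "`G` countable closed or empty,
  `G'` likewise" is `(cl G = G ∧ cl' (g '' G) = g '' G) ∨ G = ∅` (tree convention,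
  `IsWeaklyQuasiminimalPregeometryStructure.homogeneity_over_closed`).
* Closed subsets as members of the class (Def. 2, second pregeometry clause): the closed set is an
  `L`-substructure `S` (with Mathlib's induced structure `Substructure.inducedStructure`) carrying
  the restricted closure `Y ↦ S ∩ cl Y`.

## References

* L. Haykazyan, *Categoricity in quasiminimal pregeometry classes*, J. Symbolic Logic 81 (2016)
  56–64, arXiv:1308.1892: §2 (partial embeddings), Def. 2, Props 4–5, Thm 16.
* J. Kirby, *On quasiminimal excellent classes*, J. Symbolic Logic 75 (2010) 551–564,
  arXiv:0707.4496: Def. 1.1 (axioms I–II), Cor. 3.4, Thm 4.2.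
* M. Bays, B. Hart, T. Hyttinen, M. Kesälä, J. Kirby, *Quasiminimal structures and excellence*,
  Bull. London Math. Soc. 46 (2014) 155–163: Def. 2.1, Thm 2.3.
-/

noncomputable section

open Set Cardinal
open FirstOrder FirstOrder.Language

universe u v w

/-! ### Quantifier-free types across two structures -/

namespace FirstOrder.Language

variable (L : Language.{v, w}) {M : Type*} {N : Type*} {P : Type*}
  [L.Structure M] [L.Structure N] [L.Structure P] {α β : Type*}

/-- Two tuples `x : α → M`, `y : α → N` in two `L`-structures **have the same quantifier-free
type**, `qftp^M(x) = qftp^N(y)`, if they satisfy the same atomic (equivalently quantifier-free,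
`EqQFType₂.realize_iff_of_isQF`) `L`-formulas. The two-structure version of `L.EqQFType`
(deliberate dot-notation extension in Mathlib's namespace `FirstOrder.Language`, as `EqQFType`).
[folklore] -/
def EqQFType₂ (x : α → M) (y : α → N) : Prop :=
  ∀ φ : L.Formula α, BoundedFormula.IsAtomic φ → (φ.Realize x ↔ φ.Realize y)

variable {L}

/-- Inside one structure, `EqQFType₂` is `EqQFType` (by `Iff.rfl`). [folklore] -/
theorem eqQFType₂_iff_eqQFType {x y : α → M} : L.EqQFType₂ x y ↔ L.EqQFType x y := Iff.rfl

namespace EqQFType₂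

/-- Reflexivity. [folklore] -/
protected theorem refl (x : α → M) : L.EqQFType₂ x x := fun _ _ => Iff.rfl

/-- Symmetry (across the two structures). [folklore] -/
protected theorem symm {x : α → M} {y : α → N} (h : L.EqQFType₂ x y) : L.EqQFType₂ y x :=
  fun φ hφ => (h φ hφ).symm

/-- Transitivity (through a third structure). [folklore] -/
protected theorem trans {x : α → M} {y : α → N} {z : α → P} (h₁ : L.EqQFType₂ x y)
    (h₂ : L.EqQFType₂ y z) : L.EqQFType₂ x z :=
  fun φ hφ => (h₁ φ hφ).trans (h₂ φ hφ)

/-- Sub-tuples and re-indexings of tuples with the same quantifier-free type have the same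
quantifier-free type. [folklore] -/
theorem comp {x : α → M} {y : α → N} (h : L.EqQFType₂ x y) (g : β → α) :
    L.EqQFType₂ (x ∘ g) (y ∘ g) := by
  intro φ hφ
  have := h (φ.relabel g) (by
    change BoundedFormula.IsAtomic (BoundedFormula.relabel (Sum.inl ∘ g) φ)
    exact hφ.relabel _)
  simpa only [Formula.realize_relabel] using this

/-- Transport along pointwise equalities of tuples. [folklore] -/
theorem congr {x x' : α → M} {y y' : α → N} (h : L.EqQFType₂ x y) (hx : x = x') (hy : y = y') :
    L.EqQFType₂ x' y' := by
  subst hx hy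
  exact h

/-- Tuples with the same quantifier-free type have the same coincidences among coordinates.
[folklore] -/
theorem apply_eq_iff {x : α → M} {y : α → N} (h : L.EqQFType₂ x y) (i j : α) :
    x i = x j ↔ y i = y j := by
  have := h (Term.equal (var i) (var j)) (by
    change BoundedFormula.IsAtomic (Term.bdEqual _ _)
    exact BoundedFormula.IsAtomic.equal _ _)
  simpa only [Formula.realize_equal, Term.realize_var] using this

/-- Tuples with the same quantifier-free type satisfy the same quantifier-free formulas.
[folklore] -/
theorem realize_iff_of_isQF {x : α → M} {y : α → N} (h : L.EqQFType₂ x y) {φ : L.Formula α}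
    (hφ : BoundedFormula.IsQF φ) : φ.Realize x ↔ φ.Realize y := by
  induction hφ with
  | falsum => exact Iff.rfl
  | of_isAtomic ha => exact h _ ha
  | imp _ _ ih₁ ih₂ =>
    change BoundedFormula.Realize _ x default → BoundedFormula.Realize _ x default ↔
      (BoundedFormula.Realize _ y default → BoundedFormula.Realize _ y default)
    exact imp_congr ih₁ ih₂

/-- Values of terms correspond: if `qftp(x) = qftp(y)` and `x i = t(x)` then `y i = t(y)`.
[folklore] -/
theorem apply_eq_realize {x : α → M} {y : α → N} (h : L.EqQFType₂ x y) {i : α} {t : L.Term α}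
    (ht : x i = t.realize x) : y i = t.realize y := by
  have := h (Term.equal (var i) t) (by
    change BoundedFormula.IsAtomic (Term.bdEqual _ _)
    exact BoundedFormula.IsAtomic.equal _ _)
  simp only [Formula.realize_equal, Term.realize_var] at this
  exact this.1 ht

/-- An `L`-isomorphism preserves quantifier-free types: `qftp(x) = qftp(e ∘ x)`. [folklore] -/
theorem of_equiv (e : M ≃[L] N) (x : α → M) : L.EqQFType₂ x (e ∘ x) := by
  intro φ _
  exact (StrongHomClass.realize_formula e φ).symm

end EqQFType₂

end FirstOrder.Language

/-! ### Partial embeddings between two structures -/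

namespace Literature.ModelTheory.Quasiminimal

variable (L : Language.{v, w}) {M : Type*} {N : Type*} {P : Type*}
  [L.Structure M] [L.Structure N] [L.Structure P]

/-- **Partial embeddings** (Haykazyan 2016 §2; Kirby 2010 §1): `IsPartialEmbOn L f A` says that
the map `f : M → N`, restricted to `A ⊆ M`, is a partial embedding of `M` into `N` — it preserves
all quantifier-free formulas, i.e. every finite tuple from `A` has the same quantifier-free type as
its image (a formula has finitely many free variables). For `M = N` this is the tree's
`IsQFEmbOn L f A` (`isPartialEmbOn_iff_isQFEmbOn`). [cite: Haykazyan2016, §2 (partial embeddings)] -/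
def IsPartialEmbOn (f : M → N) (A : Set M) : Prop :=
  ∀ ⦃n : ℕ⦄ (x : Fin n → M), (∀ i, x i ∈ A) → L.EqQFType₂ x (f ∘ x)

variable {L}

/-- Inside one structure, `IsPartialEmbOn` is `IsQFEmbOn` (by `Iff.rfl`). [folklore] -/
theorem isPartialEmbOn_iff_isQFEmbOn {f : M → M} {A : Set M} :
    IsPartialEmbOn L f A ↔ IsQFEmbOn L f A := Iff.rfl

namespace IsPartialEmbOn

variable {f : M → N} {g : N → P} {A B : Set M}

/-- Restriction of a partial embedding. [folklore] -/
theorem mono (h : IsPartialEmbOn L f A) (hBA : B ⊆ A) : IsPartialEmbOn L f B :=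
  fun _ x hx => h x fun i => hBA (hx i)

/-- The identity is a partial embedding on any set. [folklore] -/
theorem id (A : Set M) : IsPartialEmbOn L (id : M → M) A := fun _ x _ => EqQFType₂.refl x

/-- The empty partial map is vacuously handled: a partial embedding on `∅` is the assertion that
the empty tuples have the same quantifier-free type, i.e. `M` and `N` satisfy the same
quantifier-free sentences (Haykazyan 2016, Def. 2, "quantifier free theory"). [folklore] -/
theorem of_empty_iff {f : M → N} :
    IsPartialEmbOn L f (∅ : Set M) ↔ L.EqQFType₂ (Fin.elim0 : Fin 0 → M) (Fin.elim0 : Fin 0 → N) := by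
  constructor
  · intro h
    have h0 := h (Fin.elim0 : Fin 0 → M) (fun i => i.elim0)
    have e : f ∘ (Fin.elim0 : Fin 0 → M) = Fin.elim0 := funext fun i => i.elim0
    rwa [e] at h0
  · intro h n x hx
    rcases Nat.eq_zero_or_pos n with rfl | hn
    · have ex : x = Fin.elim0 := funext fun i => i.elim0
      subst ex
      have e : f ∘ (Fin.elim0 : Fin 0 → M) = Fin.elim0 := funext fun i => i.elim0
      rw [e]
      exact h
    · exact absurd (hx ⟨0, hn⟩) (notMem_empty _)

/-- Partial embeddings only depend on their values on the set. [folklore] -/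
theorem congr {f' : M → N} (h : IsPartialEmbOn L f A) (hfg : EqOn f f' A) :
    IsPartialEmbOn L f' A := by
  intro n x hx
  have : f' ∘ x = f ∘ x := funext fun i => (hfg (hx i)).symm
  rw [this]
  exact h x hx

/-- Composition of partial embeddings. [folklore] -/
theorem comp (hf : IsPartialEmbOn L f A) (hg : IsPartialEmbOn L g (f '' A)) :
    IsPartialEmbOn L (g ∘ f) A :=
  fun _ x hx => (hf x hx).trans (hg (f ∘ x) fun i => mem_image_of_mem f (hx i))

/-- A partial embedding is injective on its set (equalities are atomic formulas). [folklore] -/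
theorem injOn (h : IsPartialEmbOn L f A) : InjOn f A := by
  intro a ha b hb hab
  have hx : ∀ i : Fin 2, ![a, b] i ∈ A := fun i => by
    refine Fin.cases ?_ (fun j => ?_) i
    · simpa using ha
    · simpa [Fin.fin_one_eq_zero j] using hb
  have h01 := ((h ![a, b] hx).apply_eq_iff 0 1).2 (by simpa using hab)
  simpa using h01

/-- A left inverse of a partial embedding is a partial embedding on the image (in the opposite
direction). [folklore] -/
theorem inverse {f' : N → M} (hf : IsPartialEmbOn L f A) (hf' : ∀ a ∈ A, f' (f a) = a) :
    IsPartialEmbOn L f' (f '' A) := by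
  intro n y hy
  choose x hxA hxy using hy
  have hyx : y = f ∘ x := funext fun i => (hxy i).symm
  have hgx : f' ∘ y = x := funext fun i => by
    rw [hyx, Function.comp_apply, Function.comp_apply, hf' _ (hxA i)]
  rw [hgx, hyx]
  exact (hf x hxA).symm

/-- A map which is a partial embedding on each member of a directed family of sets is a partial
embedding on the union (finite tuples live in one member). [folklore] -/
theorem iUnion {ι : Type*} [Nonempty ι] {A : ι → Set M} (hdir : Directed (· ⊆ ·) A)
    (h : ∀ i, IsPartialEmbOn L f (A i)) : IsPartialEmbOn L f (⋃ i, A i) := by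
  intro n x hx
  have : ∀ j : Fin n, ∃ i, x j ∈ A i := fun j => mem_iUnion.1 (hx j)
  choose i hi using this
  classical
  obtain ⟨k, hk⟩ := hdir.finset_le (Finset.univ.image i)
  exact h k x fun j => hk (i j) (Finset.mem_image_of_mem i (Finset.mem_univ j)) (hi j)

/-- An `L`-isomorphism is a partial embedding on every set. [folklore] -/
theorem of_equiv (e : M ≃[L] N) (A : Set M) : IsPartialEmbOn L e A :=
  fun _ x _ => EqQFType₂.of_equiv e x

/-- A partial embedding commutes with the interpretations of function symbols at arguments from
its set whose value also lies in the set. [folklore] -/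
theorem apply_funMap (h : IsPartialEmbOn L f A) {k : ℕ} (φ : L.Functions k) {x : Fin k → M}
    (hx : ∀ i, x i ∈ A) (hfx : Structure.funMap φ x ∈ A) :
    f (Structure.funMap φ x) = Structure.funMap φ (f ∘ x) := by
  have key := h (Fin.snoc x (Structure.funMap φ x) : Fin (k + 1) → M) (fun i => by
    refine Fin.lastCases ?_ (fun j => ?_) i
    · simpa using hfx
    · simpa using hx j)
  have ht : (Fin.snoc x (Structure.funMap φ x) : Fin (k + 1) → M) (Fin.last k) =
      (Term.func φ fun i => var (Fin.castSucc i)).realize (Fin.snoc x (Structure.funMap φ x)) := by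
    simp [Term.realize]
  have := key.apply_eq_realize ht
  simpa [Term.realize, Function.comp_def] using this

end IsPartialEmbOn

end Literature.ModelTheory.Quasiminimal

/-! ### `g ∪ (t ↦ t')` as a partial embedding -/

namespace FirstOrder.Language

variable (L : Language.{v, w}) {M : Type*} {N : Type*} [L.Structure M] [L.Structure N]

/-- **`qftp(G, t) = qftp(g[G], t')` along `g`, across two structures**: for `G ⊆ M`, a map
`g : M → N` (meant on `G`) and finite tuples `t` from `M`, `t'` from `N`, every finite tuple `σ`
from `G` followed by `t` has the same quantifier-free type as `g ∘ σ` followed by `t'` — i.e. the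
partial map `g ∪ (t ↦ t')` is a partial embedding on `G ∪ range t` (Haykazyan 2016, Def. 2:
"`g ∪ f` is a partial embedding"). Two-structure version of `L.EqQFTypeOver` (deliberate
dot-notation extension in Mathlib's namespace `FirstOrder.Language`).
[cite: Haykazyan2016, Definition 2] -/
def EqQFTypeOver₂ (G : Set M) (g : M → N) {n : ℕ} (t : Fin n → M) (t' : Fin n → N) : Prop :=
  ∀ ⦃m : ℕ⦄ (σ : Fin m → M), (∀ i, σ i ∈ G) →
    L.EqQFType₂ (Fin.append σ t) (Fin.append (g ∘ σ) t')

variable {L}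

/-- Inside one structure, `EqQFTypeOver₂` is `EqQFTypeOver` (by `Iff.rfl`). [folklore] -/
theorem eqQFTypeOver₂_iff_eqQFTypeOver {G : Set M} {g : M → M} {n : ℕ} {t t' : Fin n → M} :
    L.EqQFTypeOver₂ G g t t' ↔ L.EqQFTypeOver G g t t' := Iff.rfl

/-- `qftp(G, t) = qftp(g[G], t')` implies `qftp(t) = qftp(t')`. [folklore] -/
theorem EqQFTypeOver₂.eqQFType₂ {G : Set M} {g : M → N} {n : ℕ} {t : Fin n → M} {t' : Fin n → N}
    (h : L.EqQFTypeOver₂ G g t t') : L.EqQFType₂ t t' := by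
  have h0 := h (Fin.elim0 : Fin 0 → M) (fun i => i.elim0)
  have e1 : g ∘ (Fin.elim0 : Fin 0 → M) = Fin.elim0 := funext fun i => i.elim0
  rw [e1, Fin.elim0_append, Fin.elim0_append] at h0
  refine (h0.comp (Fin.cast (Nat.zero_add n).symm)).congr ?_ ?_ <;> funext i <;> simp

/-- A partial embedding on `G ∪ range t` gives `qftp(G, t) = qftp(g[G], g ∘ t)`. [folklore] -/
theorem _root_.Literature.ModelTheory.Quasiminimal.IsPartialEmbOn.eqQFTypeOver₂ {G : Set M}
    {g : M → N} {n : ℕ} {t : Fin n → M} (h : Literature.ModelTheory.Quasiminimal.IsPartialEmbOn L g (G ∪ range t)) :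
    L.EqQFTypeOver₂ G g t (g ∘ t) := by
  intro m σ hσ
  have : g ∘ Fin.append σ t = Fin.append (g ∘ σ) (g ∘ t) := by
    funext i
    refine Fin.addCases (fun j => ?_) (fun j => ?_) i <;> simp
  rw [← this]
  refine h _ fun i => ?_
  refine Fin.addCases (fun j => ?_) (fun j => ?_) i
  · simpa using Or.inl (hσ j)
  · simp

/-- `qftp(G, t) = qftp(g[G], t')` makes `g` a partial embedding on `G`. [folklore] -/
theorem EqQFTypeOver₂.isPartialEmbOn {G : Set M} {g : M → N} {n : ℕ} {t : Fin n → M}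
    {t' : Fin n → N} (h : L.EqQFTypeOver₂ G g t t') :
    Literature.ModelTheory.Quasiminimal.IsPartialEmbOn L g G := by
  intro m σ hσ
  have key := h σ hσ
  refine ((key.comp (Fin.castAdd n)).congr ?_ ?_) <;> funext i <;> simp


/-! ### Bookkeeping for `EqQFType₂` / `EqQFTypeOver₂` of concatenated tuples -/

section Tuples

variable {m n : ℕ}

/-- From `qftp(u, x) = qftp(u', y)`: `qftp(x) = qftp(y)`. [folklore] -/
theorem EqQFType₂.append_right {u : Fin m → M} {u' : Fin m → N} {x : Fin n → M} {y : Fin n → N}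
    (h : L.EqQFType₂ (Fin.append u x) (Fin.append u' y)) : L.EqQFType₂ x y := by
  refine (h.comp (Fin.natAdd m)).congr ?_ ?_ <;> funext i <;> simp

/-- From `qftp(u, x) = qftp(u', y)`: `qftp(u) = qftp(u')`. [folklore] -/
theorem EqQFType₂.append_left {u : Fin m → M} {u' : Fin m → N} {x : Fin n → M} {y : Fin n → N}
    (h : L.EqQFType₂ (Fin.append u x) (Fin.append u' y)) : L.EqQFType₂ u u' := by
  refine (h.comp (Fin.castAdd n)).congr ?_ ?_ <;> funext i <;> simp

/-- Tuples with the same quantifier-free type have the same coincidences among coordinates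
(as a function). [folklore] -/
theorem EqQFType₂.eq_of_eq {x : Fin n → M} {y : Fin n → N} (h : L.EqQFType₂ x y) {i j : Fin n}
    (hij : x i = x j) : y i = y j :=
  (h.apply_eq_iff i j).1 hij

/-- In `qftp(u, x) = qftp(u', y)`, a coincidence `u i = x j` forces `u' i = y j`. [folklore] -/
theorem EqQFType₂.append_eq {u : Fin m → M} {u' : Fin m → N} {x : Fin n → M} {y : Fin n → N}
    (h : L.EqQFType₂ (Fin.append u x) (Fin.append u' y)) {i : Fin m} {j : Fin n}
    (hij : u i = x j) : u' i = y j := by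
  have := h.eq_of_eq (i := Fin.castAdd n i) (j := Fin.natAdd m j) (by simpa using hij)
  simpa using this

variable {G : Set M} {g : M → N}

/-- **Symmetry of `EqQFTypeOver₂` under inverses.** If `qftp(G, t) = qftp(g[G], t')` and `g'`
inverts `g` on `G`, then `qftp(g[G], t') = qftp(g'[g[G]], t)` along `g'`. [folklore] -/
theorem EqQFTypeOver₂.symm_of_inverse {g' : N → M} {k : ℕ} {t : Fin k → M} {t' : Fin k → N}
    (h : L.EqQFTypeOver₂ G g t t') (hg' : ∀ a ∈ G, g' (g a) = a) :
    L.EqQFTypeOver₂ (g '' G) g' t' t := by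
  intro m σ' hσ'
  choose σ hσG hσ using hσ'
  have h1 : (σ' : Fin m → N) = g ∘ σ := funext fun i => (hσ i).symm
  have h2 : g' ∘ σ' = σ := funext fun i => by
    rw [Function.comp_apply, ← hσ i, hg' _ (hσG i)]
  rw [h2, h1]
  exact (h σ hσG).symm

/-- `EqQFTypeOver₂` with trailing matched tuples dropped. [folklore] -/
theorem EqQFTypeOver₂.append_left' {k n : ℕ} {t : Fin k → M} {t' : Fin k → N} {x : Fin n → M}
    {y : Fin n → N} (h : L.EqQFTypeOver₂ G g (Fin.append t x) (Fin.append t' y)) :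
    L.EqQFTypeOver₂ G g t t' := by
  intro m σ hσ
  have := h σ hσ
  have e1 : Fin.append σ (Fin.append t x) =
      Fin.append (Fin.append σ t) x ∘ Fin.cast (Nat.add_assoc ..).symm := by
    rw [Fin.append_assoc]
    rfl
  have e2 : Fin.append (g ∘ σ) (Fin.append t' y) =
      Fin.append (Fin.append (g ∘ σ) t') y ∘ Fin.cast (Nat.add_assoc ..).symm := by
    rw [Fin.append_assoc]
    rfl
  rw [e1, e2] at this
  have := (this.comp (Fin.cast (Nat.add_assoc ..))).append_left
  · refine this.congr ?_ ?_ <;> funext i <;> simp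

/-- `EqQFTypeOver₂` is stable under re-indexing the matched tuples. [folklore] -/
theorem EqQFTypeOver₂.comp_right {k n : ℕ} {t : Fin k → M} {t' : Fin k → N}
    (h : L.EqQFTypeOver₂ G g t t') (ι : Fin n → Fin k) :
    L.EqQFTypeOver₂ G g (t ∘ ι) (t' ∘ ι) := by
  intro m σ hσ
  let κ : Fin (m + n) → Fin (m + k) := fun i =>
    Fin.addCases (fun j => Fin.castAdd k j) (fun j => Fin.natAdd m (ι j)) i
  have e1 : Fin.append σ (t ∘ ι) = Fin.append σ t ∘ κ := by
    funext i
    refine Fin.addCases (fun j => ?_) (fun j => ?_) i <;> simp [κ]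
  have e2 : Fin.append (g ∘ σ) (t' ∘ ι) = Fin.append (g ∘ σ) t' ∘ κ := by
    funext i
    refine Fin.addCases (fun j => ?_) (fun j => ?_) i <;> simp [κ]
  rw [e1, e2]
  exact (h σ hσ).comp κ

/-- `EqQFTypeOver₂ G g t t'` with the tuples padded by the empty tuple. [folklore] -/
theorem EqQFTypeOver₂.append_elim0 {k : ℕ} {t : Fin k → M} {t' : Fin k → N}
    (h : L.EqQFTypeOver₂ G g t t') :
    L.EqQFTypeOver₂ G g (Fin.append t Fin.elim0) (Fin.append t' Fin.elim0) := by
  rw [Fin.append_elim0, Fin.append_elim0]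
  exact h.comp_right _

/-- Coincidences of the matched tuples: `t i = t j ↔ t' i = t' j`. [folklore] -/
theorem EqQFTypeOver₂.apply_eq_iff {k : ℕ} {t : Fin k → M} {t' : Fin k → N}
    (h : L.EqQFTypeOver₂ G g t t') (i j : Fin k) : t i = t j ↔ t' i = t' j :=
  h.eqQFType₂.apply_eq_iff i j

/-- In `qftp(G, t) = qftp(g[G], t')`, a coincidence `a = t j` with `a ∈ G` forces `g a = t' j`.
[folklore] -/
theorem EqQFTypeOver₂.apply_eq_of_mem {k : ℕ} {t : Fin k → M} {t' : Fin k → N}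
    (h : L.EqQFTypeOver₂ G g t t') {a : M} (ha : a ∈ G) {j : Fin k} (hj : a = t j) :
    g a = t' j := by
  have := h ![a] (fun i => by simpa using ha)
  have key := this.append_eq (i := 0) (j := j) (by simpa using hj)
  simpa using key

/-- Over `G = ∅`, `qftp(G, t) = qftp(g[G], t')` is just `qftp(t) = qftp(t')`. [folklore] -/
theorem eqQFTypeOver₂_empty_iff {k : ℕ} {t : Fin k → M} {t' : Fin k → N} :
    L.EqQFTypeOver₂ (∅ : Set M) g t t' ↔ L.EqQFType₂ t t' := by
  refine ⟨fun h => h.eqQFType₂, fun h m σ hσ => ?_⟩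
  rcases Nat.eq_zero_or_pos m with rfl | hm
  · have e0 : σ = Fin.elim0 := funext fun i => i.elim0
    subst e0
    have e1 : g ∘ (Fin.elim0 : Fin 0 → M) = Fin.elim0 := funext fun i => i.elim0
    rw [e1, Fin.elim0_append, Fin.elim0_append]
    exact h.comp _
  · exact absurd (hσ ⟨0, hm⟩) (Set.notMem_empty _)

end Tuples

end FirstOrder.Language

/-! ### Quasiminimal pregeometry classes -/

namespace Literature.ModelTheory.Quasiminimal

variable (L : Language.{v, w})

/-- The closure operator induced on a subset `S ⊆ H` by a closure operator `cl` on `H`: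
`Y ↦ S ∩ cl Y` ("the restriction of `cl_H`", Haykazyan 2016, Def. 2; meaningful when `S` is
closed, so that closures of subsets of `S` stay inside `S`). [folklore] -/
def restrictCl {H : Type u} (cl : Set H → Set H) (S : Set H) : Set S → Set S :=
  fun Y => Subtype.val ⁻¹' cl (Subtype.val '' Y)

/-- Unfolding `restrictCl`. [folklore] -/
theorem mem_restrictCl_iff {H : Type u} {cl : Set H → Set H} {S : Set H} {Y : Set S} {s : S} :
    s ∈ restrictCl cl S Y ↔ (s : H) ∈ cl (Subtype.val '' Y) := Iff.rfl

/-- **Quasiminimal pregeometry classes** (Haykazyan 2016, Definition 2; after Zilber 2005 and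
Kirby 2010, Def. 1.1, axioms 0, I, II). A class `𝒞` of pairs `⟨H, cl_H⟩` — an `L`-structure `H`
(here: a type of the universe `u` with an `L`-structure instance) and an operator
`cl_H : Set H → Set H` — is a *quasiminimal pregeometry class* if:

1. (closure under isomorphisms) if `⟨H, cl_H⟩ ∈ 𝒞` and `f : H → H'` is an isomorphism of
   `L`-structures then `⟨H', f cl_H f⁻¹⟩ ∈ 𝒞`;
2. (quantifier-free theory) any two structures in `𝒞` satisfy the same quantifier-free
   sentences, i.e. the empty map is a partial embedding between any two of them;
3. (pregeometry) (i) each `cl_H` is a pregeometry on `H` in which the closure of a finite set is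
   countable; (ii) for `X ⊆ H`, the closed set `cl_H X` (an `L`-substructure) with the restriction
   of `cl_H` is in `𝒞`; (iii) if `f : H ⇀ H'` is a partial embedding defined on `X ∪ {y}` then
   `y ∈ cl_H X ↔ f y ∈ cl_{H'} (f X)`;
4. (`ℵ₀`-homogeneity over countable closed models) for `⟨H, cl_H⟩, ⟨H', cl_{H'}⟩ ∈ 𝒞`,
   `G ⊆ H`, `G' ⊆ H'` countable closed subsets or empty and `g : G → G'` an isomorphism:
   (i) if `x ∈ H`, `x' ∈ H'` are independent from `G`, `G'` then `g ∪ {(x, x')}` is a partial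
   embedding; (ii) if `g ∪ f` is a partial embedding with `dom f = X` finite and
   `y ∈ cl_H (X ∪ G)` then there is `y' ∈ H'` with `g ∪ f ∪ {(y, y')}` a partial embedding.

Rendering: partial maps are total maps plus their intended domain (`IsPartialEmbOn`,
`EqQFTypeOver₂`); `G' = g '' G`; "independent from `G`" is `∉ cl G`; finite `X = dom f` is the
range of a tuple `x : Fin n → H` with `f x = x'`. Axiom 4 is recorded twice: for `G, G'` countable
CLOSED along a total map `g : H → H'` (fields `…_of_closed`), and for `G = G' = ∅` in map-free
form (fields `eqQFType₂_of_notMem_cl_empty`, `exists_eqQFType₂_snoc`) — over `∅` the source's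
statement needs no map at all, and a total `H → H'` need not exist when `H'` is empty; the
combined forms with the hypothesis "`G` closed or `G = ∅`" are the theorems
`eqQFTypeOver₂_of_notMem_cl` and `exists_eqQFTypeOver₂_snoc` below. No countability of `L` is
assumed (none is in the source). [cite: Haykazyan2016, Definition 2] -/
structure IsQuasiminimalPregeometryClass
    (𝒞 : ∀ (H : Type u) [L.Structure H], (Set H → Set H) → Prop) : Prop where
  /-- (1) closure under isomorphisms, transporting the closure operator -/
  of_equiv : ∀ {H H' : Type u} [L.Structure H] [L.Structure H'] {cl : Set H → Set H},
    𝒞 H cl → ∀ e : H ≃[L] H', 𝒞 H' (fun X' => e '' cl (e ⁻¹' X'))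
  /-- (2) any two members satisfy the same quantifier-free sentences -/
  eqQFType₂_elim0 : ∀ {H H' : Type u} [L.Structure H] [L.Structure H'] {cl : Set H → Set H}
    {cl' : Set H' → Set H'}, 𝒞 H cl → 𝒞 H' cl' →
      L.EqQFType₂ (Fin.elim0 : Fin 0 → H) (Fin.elim0 : Fin 0 → H')
  /-- (3i) `cl_H` is a pregeometry … -/
  isPregeometry : ∀ {H : Type u} [L.Structure H] {cl : Set H → Set H}, 𝒞 H cl → IsPregeometry cl
  /-- (3i) … with the countable closure property -/
  countable_cl : ∀ {H : Type u} [L.Structure H] {cl : Set H → Set H}, 𝒞 H cl →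
    ∀ A : Set H, A.Finite → (cl A).Countable
  /-- (3ii) closed sets, with the induced structure and the restricted closure, are in the class -/
  cl_mem : ∀ {H : Type u} [L.Structure H] {cl : Set H → Set H}, 𝒞 H cl → ∀ X : Set H,
    ∃ S : L.Substructure H, (S : Set H) = cl X ∧ 𝒞 S (restrictCl cl (S : Set H))
  /-- (3iii) the closure is determined by partial embeddings -/
  mem_cl_iff_of_isPartialEmbOn : ∀ {H H' : Type u} [L.Structure H] [L.Structure H']
    {cl : Set H → Set H} {cl' : Set H' → Set H'}, 𝒞 H cl → 𝒞 H' cl' →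
      ∀ (X : Set H) (y : H) (f : H → H'), IsPartialEmbOn L f (insert y X) →
        (y ∈ cl X ↔ f y ∈ cl' (f '' X))
  /-- (4i), over `∅`: uniqueness of the generic type — points outside `cl ∅` in two members have
  the same quantifier-free type -/
  eqQFType₂_of_notMem_cl_empty : ∀ {H H' : Type u} [L.Structure H] [L.Structure H']
    {cl : Set H → Set H} {cl' : Set H' → Set H'}, 𝒞 H cl → 𝒞 H' cl' →
      ∀ ⦃x : H⦄ ⦃x' : H'⦄, x ∉ cl ∅ → x' ∉ cl' ∅ → L.EqQFType₂ ![x] ![x']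
  /-- (4ii), over `∅`: `ℵ₀`-homogeneity — a finite partial embedding `x ↦ x'` extends over any
  point of `cl (range x)` -/
  exists_eqQFType₂_snoc : ∀ {H H' : Type u} [L.Structure H] [L.Structure H']
    {cl : Set H → Set H} {cl' : Set H' → Set H'}, 𝒞 H cl → 𝒞 H' cl' →
      ∀ ⦃n : ℕ⦄ (x : Fin n → H) (x' : Fin n → H'), L.EqQFType₂ x x' →
        ∀ ⦃y : H⦄, y ∈ cl (range x) →
          ∃ y' : H', L.EqQFType₂ (Fin.snoc x y : Fin (n + 1) → H) (Fin.snoc x' y')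
  /-- (4i), over countable closed `G ≅ G'`: uniqueness of the generic type -/
  eqQFTypeOver₂_of_notMem_of_closed : ∀ {H H' : Type u} [L.Structure H] [L.Structure H']
    {cl : Set H → Set H} {cl' : Set H' → Set H'}, 𝒞 H cl → 𝒞 H' cl' →
      ∀ (G : Set H) (g : H → H'), G.Countable → cl G = G → cl' (g '' G) = g '' G →
        IsPartialEmbOn L g G → ∀ ⦃x : H⦄ ⦃x' : H'⦄, x ∉ cl G → x' ∉ cl' (g '' G) →
          L.EqQFTypeOver₂ G g ![x] ![x']
  /-- (4ii), over countable closed `G ≅ G'`: `ℵ₀`-homogeneity -/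
  exists_eqQFTypeOver₂_snoc_of_closed : ∀ {H H' : Type u} [L.Structure H] [L.Structure H']
    {cl : Set H → Set H} {cl' : Set H' → Set H'}, 𝒞 H cl → 𝒞 H' cl' →
      ∀ (G : Set H) (g : H → H'), G.Countable → cl G = G → cl' (g '' G) = g '' G →
        ∀ ⦃n : ℕ⦄ (x : Fin n → H) (x' : Fin n → H'), L.EqQFTypeOver₂ G g x x' →
          ∀ ⦃y : H⦄, y ∈ cl (G ∪ range x) →
            ∃ y' : H', L.EqQFTypeOver₂ G g (Fin.snoc x y : Fin (n + 1) → H) (Fin.snoc x' y')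

variable {L}

/-! ### Bases and the cardinality of uncountable members -/

section Bases

variable {H : Type u} {cl : Set H → Set H}

/-- **Bases of a pregeometry exist**: an independent set whose closure is everything (a base of the
matroid of the pregeometry, `IsPregeometry.matroid`). [folklore] -/
theorem IsPregeometry.exists_clBase (h : IsPregeometry cl) :
    ∃ B : Set H, ClIndep cl B ∧ cl B = Set.univ := by
  obtain ⟨B, hB⟩ := h.matroid.exists_isBase
  refine ⟨B, (h.matroid_indep_iff).1 hB.indep, ?_⟩
  have := hB.closure_eq
  rwa [h.matroid_closure, h.matroid_E] at this

/-- **A spanning set of an uncountable pregeometry with countable closures of finite sets has the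
cardinality of the whole structure**: `H = cl B = ⋃ {cl X : X ⊆ B finite}` with each `cl X`
countable, so `#H ≤ #(Finset B) · ℵ₀ = #B` once `B` is infinite, and `B` is infinite since
otherwise `H = cl B` would be countable. (The count behind "the cardinality of `B_λ` is
`λ + ℵ₀`", Bays–Kirby 2013, Thm 1; Kirby 2010, Cor. 3.4.) [folklore] -/
theorem IsPregeometry.mk_eq_mk_of_cl_eq_univ [Uncountable H] (h : IsPregeometry cl)
    (hccp : ∀ A : Set H, A.Finite → (cl A).Countable) {B : Set H} (hB : cl B = Set.univ) :
    #B = #H := by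
  classical
  refine le_antisymm (mk_set_le B) ?_
  -- `B` is infinite
  have hBinf : B.Infinite := by
    intro hBfin
    have : (Set.univ : Set H).Countable := hB ▸ hccp B hBfin
    exact not_countable_univ this
  haveI : Infinite B := hBinf.to_subtype
  -- cover `H` by the closures of the finite subsets of `B`
  have hcover : (Set.univ : Set H) ⊆ ⋃ X : Finset B, cl ((↑) '' (X : Set B)) := by
    intro x _
    have hx : x ∈ cl B := hB ▸ Set.mem_univ x
    obtain ⟨A₀, hA₀B, hA₀fin, hxA₀⟩ := h.finite_character hx
    let X : Finset B := (hA₀fin.preimage Subtype.val_injective.injOn).toFinset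
    refine mem_iUnion.2 ⟨X, h.mono ?_ hxA₀⟩
    intro a ha
    exact ⟨⟨a, hA₀B ha⟩, by simp [X, ha], rfl⟩
  have h1 : #H ≤ #(Finset B) * ℵ₀ := by
    rw [← mk_univ (α := H)]
    refine (mk_le_mk_of_subset hcover).trans ((mk_iUnion_le _).trans ?_)
    refine mul_le_mul' le_rfl (ciSup_le' fun X => ?_)
    exact (hccp _ ((X : Set B).toFinite.image _)).le_aleph0
  rw [mk_finset_of_infinite, mul_aleph0_eq (aleph0_le_mk B)] at h1
  exact h1

end Bases

/-! ### Categoricity in uncountable powers from Haykazyan's Theorem 16 -/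

namespace IsQuasiminimalPregeometryClass

variable {𝒞 : ∀ (H : Type u) [L.Structure H], (Set H → Set H) → Prop}

/-- **Categoricity in each uncountable cardinal, granted the extension of bijections of bases**
(Haykazyan 2016, Thm 16 ⟹ "two structures in a quasiminimal pregeometry class of the same
uncountable cardinality are isomorphic", ibid. §1 and Kirby 2010, Cor. 3.4). The hypothesis
`h16` is the conclusion of Haykazyan's Theorem 16 for the class `𝒞` (NOT proved in this file):
for uncountable `H, H' ∈ 𝒞` with bases `B, B'` and a bijection `B ≃ B'` there is an isomorphism
`H ≃[L] H'` extending it. Given that, members `H, H'` with `#H = #H'` uncountable are isomorphic: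
bases have the cardinality of the structure (`IsPregeometry.mk_eq_mk_of_cl_eq_univ`), so they are
in bijection. [cite: Haykazyan2016, Theorem 16] -/
theorem nonempty_equiv_of_mk_eq (h𝒞 : IsQuasiminimalPregeometryClass L 𝒞)
    (h16 : ∀ {H H' : Type u} [L.Structure H] [L.Structure H'] {cl : Set H → Set H}
      {cl' : Set H' → Set H'}, 𝒞 H cl → 𝒞 H' cl' → Uncountable H → Uncountable H' →
      ∀ (B : Set H) (B' : Set H'), ClIndep cl B → cl B = Set.univ → ClIndep cl' B' → cl' B' = Set.univ →
        ∀ e : B ≃ B', ∃ f : H ≃[L] H', ∀ b : B, f b = e b)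
    {H H' : Type u} [L.Structure H] [L.Structure H'] {cl : Set H → Set H}
    {cl' : Set H' → Set H'} (hH : 𝒞 H cl) (hH' : 𝒞 H' cl') [Uncountable H] (hcard : #H = #H') :
    Nonempty (H ≃[L] H') := by
  haveI : Uncountable H' := by
    rw [← aleph0_lt_mk_iff, ← hcard]
    exact aleph0_lt_mk
  obtain ⟨B, hBind, hBcl⟩ := (h𝒞.isPregeometry hH).exists_clBase
  obtain ⟨B', hB'ind, hB'cl⟩ := (h𝒞.isPregeometry hH').exists_clBase
  have hBB' : #B = #B' := by
    rw [(h𝒞.isPregeometry hH).mk_eq_mk_of_cl_eq_univ (h𝒞.countable_cl hH) hBcl,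
      (h𝒞.isPregeometry hH').mk_eq_mk_of_cl_eq_univ (h𝒞.countable_cl hH') hB'cl, hcard]
  obtain ⟨e⟩ := Cardinal.eq.1 hBB'
  obtain ⟨f, -⟩ := h16 hH hH' ‹_› ‹_› B B' hBind hBcl hB'ind hB'cl e
  exact ⟨f⟩

end IsQuasiminimalPregeometryClass

/-! ### The countable back-and-forth engine, across two structures -/

section BackAndForth

variable {M : Type*} {N : Type*}

/-- Extending a tuple stored as an `ℕ`-sequence (copy of
`IsWeaklyQuasiminimalPregeometryStructure.tuple_update_eq_snoc`, for any type). [folklore] -/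
theorem tuple_update_eq_snoc' {X : Type*} (x : ℕ → X) (k : ℕ) (a : X) :
    (fun i : Fin (k + 1) => if (i : ℕ) = k then a else x i) =
      (Fin.snoc (fun i : Fin k => x i) a : Fin (k + 1) → X) := by
  funext i
  refine Fin.lastCases ?_ (fun j => ?_) i
  · simp
  · have hj : (j : ℕ) ≠ k := Nat.ne_of_lt j.isLt
    simp [Fin.snoc_castSucc, hj]

/-- **Abstract back-and-forth between two structures** (the "standard back-and-forth argument":
Kirby 2010, proofs of Thm 2.1 and Lemma 3.2; Haykazyan 2016, proof of Prop. 5). Let `S n x y`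
relate `n`-tuples from `M` with `n`-tuples from `N`, hold for the empty tuples, preserve
coincidences of coordinates, and be extendable by any point of the countable set `C ⊆ M` on the
left ("forth") and any point of the countable `C' ⊆ N` on the right ("back"). Then there is a map
`g : M → N` with `g '' C = C'` all of whose restrictions to finite tuples from `C` are covered by
related pairs. (Two-structure copy of `exists_map_of_backAndForth`.) [folklore] -/
theorem exists_map_of_backAndForth₂ [hMN : Nonempty (M → N)]
    {S : ∀ n : ℕ, (Fin n → M) → (Fin n → N) → Prop}
    {C : Set M} {C' : Set N} (hC : C.Countable) (hC' : C'.Countable)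
    (h0 : S 0 Fin.elim0 Fin.elim0)
    (hwd : ∀ ⦃n⦄ ⦃x : Fin n → M⦄ ⦃y : Fin n → N⦄, S n x y → ∀ i j, x i = x j ↔ y i = y j)
    (forth : ∀ ⦃n⦄ ⦃x : Fin n → M⦄ ⦃y : Fin n → N⦄, S n x y → (∀ i, x i ∈ C) → (∀ i, y i ∈ C') →
      ∀ a ∈ C, ∃ b ∈ C', S (n + 1) (Fin.snoc x a) (Fin.snoc y b))
    (back : ∀ ⦃n⦄ ⦃x : Fin n → M⦄ ⦃y : Fin n → N⦄, S n x y → (∀ i, x i ∈ C) → (∀ i, y i ∈ C') →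
      ∀ b ∈ C', ∃ a ∈ C, S (n + 1) (Fin.snoc x a) (Fin.snoc y b)) :
    ∃ g : M → N, g '' C = C' ∧
      ∀ ⦃m : ℕ⦄ (σ : Fin m → M), (∀ i, σ i ∈ C) →
        ∃ (n : ℕ) (x : Fin n → M) (y : Fin n → N), S n x y ∧ (∀ i, x i ∈ C) ∧ (∀ i, y i ∈ C') ∧
          ∃ ι : Fin m → Fin n, x ∘ ι = σ ∧ y ∘ ι = g ∘ σ := by
  classical
  -- degenerate cases
  by_cases hCe : C = ∅
  · have hC'e : C' = ∅ := by
      by_contra hne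
      obtain ⟨b, hb⟩ := nonempty_iff_ne_empty.2 hne
      obtain ⟨a, ha, -⟩ := back h0 (fun i => i.elim0) (fun i => i.elim0) b hb
      rw [hCe] at ha
      exact ha
    subst hCe hC'e
    obtain ⟨g⟩ := hMN
    refine ⟨g, by simp, fun m σ hσ => ?_⟩
    rcases Nat.eq_zero_or_pos m with rfl | hm
    · refine ⟨0, Fin.elim0, Fin.elim0, h0, fun i => i.elim0, fun i => i.elim0, Fin.elim0, ?_, ?_⟩ <;>
        funext i <;> exact i.elim0
    · exact absurd (hσ ⟨0, hm⟩) (notMem_empty _)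
  by_cases hC'e : C' = ∅
  · exfalso
    obtain ⟨a, ha⟩ := nonempty_iff_ne_empty.2 hCe
    obtain ⟨b, hb, -⟩ := forth h0 (fun i => i.elim0) (fun i => i.elim0) a ha
    rw [hC'e] at hb
    exact hb
  have hCne : C.Nonempty := nonempty_iff_ne_empty.2 hCe
  have hC'ne : C'.Nonempty := nonempty_iff_ne_empty.2 hC'e
  obtain ⟨e, he⟩ := hC.exists_eq_range hCne
  obtain ⟨e', he'⟩ := hC'.exists_eq_range hC'ne
  -- states
  let tup : ℕ × (ℕ → M) × (ℕ → N) → (k : ℕ) → (Fin k → M) × (Fin k → N) :=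
    fun s k => (fun i => s.2.1 i, fun i => s.2.2 i)
  let s₀ : ℕ × (ℕ → M) × (ℕ → N) := (0, fun _ => e 0, fun _ => e' 0)
  let Ext : (ℕ × (ℕ → M) × (ℕ → N)) → (ℕ × (ℕ → M) × (ℕ → N)) → Prop := fun s s' =>
    s.1 ≤ s'.1 ∧ ∀ i < s.1, s'.2.1 i = s.2.1 i ∧ s'.2.2 i = s.2.2 i
  let Good : (ℕ × (ℕ → M) × (ℕ → N)) → Prop := fun s =>
    S s.1 (tup s s.1).1 (tup s s.1).2 ∧ (∀ i < s.1, s.2.1 i ∈ C) ∧ (∀ i < s.1, s.2.2 i ∈ C')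
  have hExt_refl : ∀ s, Ext s s := fun s => ⟨le_rfl, fun i _ => ⟨rfl, rfl⟩⟩
  have hExt_trans : ∀ s s' s'', Ext s s' → Ext s' s'' → Ext s s'' := by
    rintro s s' s'' ⟨h1, h1'⟩ ⟨h2, h2'⟩
    refine ⟨h1.trans h2, fun i hi => ?_⟩
    obtain ⟨ha, hb⟩ := h1' i hi
    obtain ⟨ha', hb'⟩ := h2' i (lt_of_lt_of_le hi h1)
    exact ⟨ha'.trans ha, hb'.trans hb⟩
  have hGood₀ : Good s₀ := by
    refine ⟨?_, fun i hi => absurd hi (Nat.not_lt_zero i), fun i hi => absurd hi (Nat.not_lt_zero i)⟩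
    have e1 : (tup s₀ 0).1 = Fin.elim0 := funext fun i => i.elim0
    have e2 : (tup s₀ 0).2 = Fin.elim0 := funext fun i => i.elim0
    change S 0 (tup s₀ 0).1 (tup s₀ 0).2
    rw [e1, e2]
    exact h0
  -- forth step
  have hforth : ∀ s, Good s → ∀ a ∈ C, ∃ s', Good s' ∧ Ext s s' ∧ s'.1 = s.1 + 1 ∧
      s'.2.1 s.1 = a := by
    rintro s ⟨hS, hm1, hm2⟩ a ha
    obtain ⟨b, hb, hS'⟩ := forth hS (fun i => hm1 i i.isLt) (fun i => hm2 i i.isLt) a ha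
    let s' : ℕ × (ℕ → M) × (ℕ → N) :=
      (s.1 + 1, fun i => if i = s.1 then a else s.2.1 i, fun i => if i = s.1 then b else s.2.2 i)
    have hext : Ext s s' := ⟨Nat.le_succ _, fun i hi =>
      ⟨(if_neg (Nat.ne_of_lt hi) : (if i = s.1 then a else s.2.1 i) = s.2.1 i),
        (if_neg (Nat.ne_of_lt hi) : (if i = s.1 then b else s.2.2 i) = s.2.2 i)⟩⟩
    refine ⟨s', ⟨?_, ?_, ?_⟩, hext, rfl, by simp [s']⟩
    · change S (s.1 + 1) (fun i : Fin (s.1 + 1) => if (i : ℕ) = s.1 then a else s.2.1 i)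
        (fun i : Fin (s.1 + 1) => if (i : ℕ) = s.1 then b else s.2.2 i)
      rw [tuple_update_eq_snoc', tuple_update_eq_snoc']
      exact hS'
    · intro i hi
      change (if i = s.1 then a else s.2.1 i) ∈ C
      split_ifs with hi'
      · exact ha
      · exact hm1 i (by change i < s.1 + 1 at hi; omega)
    · intro i hi
      change (if i = s.1 then b else s.2.2 i) ∈ C'
      split_ifs with hi'
      · exact hb
      · exact hm2 i (by change i < s.1 + 1 at hi; omega)
  -- back step
  have hback : ∀ s, Good s → ∀ b ∈ C', ∃ s', Good s' ∧ Ext s s' ∧ s'.1 = s.1 + 1 ∧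
      s'.2.2 s.1 = b := by
    rintro s ⟨hS, hm1, hm2⟩ b hb
    obtain ⟨a, ha, hS'⟩ := back hS (fun i => hm1 i i.isLt) (fun i => hm2 i i.isLt) b hb
    let s' : ℕ × (ℕ → M) × (ℕ → N) :=
      (s.1 + 1, fun i => if i = s.1 then a else s.2.1 i, fun i => if i = s.1 then b else s.2.2 i)
    have hext : Ext s s' := ⟨Nat.le_succ _, fun i hi =>
      ⟨(if_neg (Nat.ne_of_lt hi) : (if i = s.1 then a else s.2.1 i) = s.2.1 i),
        (if_neg (Nat.ne_of_lt hi) : (if i = s.1 then b else s.2.2 i) = s.2.2 i)⟩⟩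
    refine ⟨s', ⟨?_, ?_, ?_⟩, hext, rfl, by simp [s']⟩
    · change S (s.1 + 1) (fun i : Fin (s.1 + 1) => if (i : ℕ) = s.1 then a else s.2.1 i)
        (fun i : Fin (s.1 + 1) => if (i : ℕ) = s.1 then b else s.2.2 i)
      rw [tuple_update_eq_snoc', tuple_update_eq_snoc']
      exact hS'
    · intro i hi
      change (if i = s.1 then a else s.2.1 i) ∈ C
      split_ifs with hi'
      · exact ha
      · exact hm1 i (by change i < s.1 + 1 at hi; omega)
    · intro i hi
      change (if i = s.1 then b else s.2.2 i) ∈ C'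
      split_ifs with hi'
      · exact hb
      · exact hm2 i (by change i < s.1 + 1 at hi; omega)
  -- combined step
  have hstep : ∀ s, Good s → ∀ j : ℕ, ∃ s', Good s' ∧ Ext s s' ∧
      (∃ i < s'.1, s'.2.1 i = e j) ∧ (∃ i < s'.1, s'.2.2 i = e' j) := by
    intro s hs j
    obtain ⟨s₁, hs₁, hext₁, hlen₁, hval₁⟩ := hforth s hs (e j) (he ▸ mem_range_self j)
    obtain ⟨s₂, hs₂, hext₂, hlen₂, hval₂⟩ := hback s₁ hs₁ (e' j) (he' ▸ mem_range_self j)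
    refine ⟨s₂, hs₂, hExt_trans _ _ _ hext₁ hext₂, ⟨s.1, by omega, ?_⟩, ⟨s₁.1, by omega, hval₂⟩⟩
    rw [(hext₂.2 s.1 (by omega)).1, hval₁]
  choose! F hF using hstep
  let seq : ℕ → ℕ × (ℕ → M) × (ℕ → N) := fun j => Nat.rec s₀ (fun j s => F s j) j
  have hseq_succ : ∀ j, seq (j + 1) = F (seq j) j := fun j => rfl
  have hGood : ∀ j, Good (seq j) := by
    intro j
    induction j with
    | zero => exact hGood₀
    | succ j ih => rw [hseq_succ]; exact (hF _ ih j).1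
  have hExt_succ : ∀ j, Ext (seq j) (seq (j + 1)) := fun j => by
    rw [hseq_succ]; exact (hF _ (hGood j) j).2.1
  have hExt_le : ∀ {j j'}, j ≤ j' → Ext (seq j) (seq j') := by
    intro j j' hjj'
    induction hjj' with
    | refl => exact hExt_refl _
    | step _ ih => exact hExt_trans _ _ _ ih (hExt_succ _)
  -- the graph of the limit map
  let R : M → N → Prop := fun m m' => ∃ j, ∃ i < (seq j).1, (seq j).2.1 i = m ∧ (seq j).2.2 i = m'
  have hR_lift : ∀ {m m' j J}, j ≤ J → (∃ i < (seq j).1, (seq j).2.1 i = m ∧ (seq j).2.2 i = m') →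
      ∃ i < (seq J).1, (seq J).2.1 i = m ∧ (seq J).2.2 i = m' := by
    rintro m m' j J hjJ ⟨i, hi, h1, h2⟩
    obtain ⟨hle, hext⟩ := hExt_le hjJ
    exact ⟨i, lt_of_lt_of_le hi hle, (hext i hi).1.trans h1, (hext i hi).2.trans h2⟩
  have hR_fun : ∀ {m m₁ m₂}, R m m₁ → R m m₂ → m₁ = m₂ := by
    rintro m m₁ m₂ ⟨j₁, hj₁⟩ ⟨j₂, hj₂⟩
    obtain ⟨i₁, hi₁, h₁, h₁'⟩ := hR_lift (le_max_left j₁ j₂) hj₁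
    obtain ⟨i₂, hi₂, h₂, h₂'⟩ := hR_lift (le_max_right j₁ j₂) hj₂
    obtain ⟨hS, -, -⟩ := hGood (max j₁ j₂)
    have := (hwd hS ⟨i₁, hi₁⟩ ⟨i₂, hi₂⟩).1 (h₁.trans h₂.symm)
    rw [← h₁', ← h₂']
    exact this
  have hR_mem : ∀ {m m'}, R m m' → m ∈ C ∧ m' ∈ C' := by
    rintro m m' ⟨j, i, hi, rfl, rfl⟩
    obtain ⟨-, h1, h2⟩ := hGood j
    exact ⟨h1 i hi, h2 i hi⟩
  have hR_dom : ∀ m ∈ C, ∃ m', R m m' := by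
    intro m hm
    rw [he] at hm
    obtain ⟨j, rfl⟩ := hm
    obtain ⟨-, -, ⟨i, hi, hval⟩, -⟩ := hF _ (hGood j) j
    exact ⟨(seq (j + 1)).2.2 i, j + 1, i, hi, hval, rfl⟩
  have hR_ran : ∀ m' ∈ C', ∃ m, R m m' := by
    intro m' hm'
    rw [he'] at hm'
    obtain ⟨j, rfl⟩ := hm'
    obtain ⟨-, -, -, ⟨i, hi, hval⟩⟩ := hF _ (hGood j) j
    exact ⟨(seq (j + 1)).2.1 i, j + 1, i, hi, rfl, hval⟩
  -- the limit map
  let g : M → N := fun m => if hm : ∃ m', R m m' then hm.choose else e' 0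
  have hg : ∀ {m m'}, R m m' → g m = m' := by
    intro m m' hmm'
    have hex : ∃ m', R m m' := ⟨m', hmm'⟩
    simp only [g, dif_pos hex]
    exact hR_fun hex.choose_spec hmm'
  have hgR : ∀ m ∈ C, R m (g m) := by
    intro m hm
    obtain ⟨m', hmm'⟩ := hR_dom m hm
    rwa [hg hmm']
  refine ⟨g, ?_, ?_⟩
  · apply Subset.antisymm
    · rintro _ ⟨m, hm, rfl⟩
      exact (hR_mem (hgR m hm)).2
    · intro m' hm'
      obtain ⟨m, hmm'⟩ := hR_ran m' hm'
      exact ⟨m, (hR_mem hmm').1, hg hmm'⟩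
  · intro m σ hσ
    have : ∀ i, ∃ j, ∃ p < (seq j).1, (seq j).2.1 p = σ i ∧ (seq j).2.2 p = g (σ i) :=
      fun i => hgR (σ i) (hσ i)
    choose j p hp hpσ hpg using this
    obtain ⟨J, hJ⟩ : ∃ J, ∀ i, j i ≤ J :=
      ⟨Finset.univ.sup j, fun i => Finset.le_sup (Finset.mem_univ i)⟩
    obtain ⟨hS, h1, h2⟩ := hGood J
    have hpJ : ∀ i, p i < (seq J).1 := fun i => lt_of_lt_of_le (hp i) (hExt_le (hJ i)).1
    refine ⟨(seq J).1, (tup (seq J) (seq J).1).1, (tup (seq J) (seq J).1).2, hS,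
      fun i => h1 i i.isLt, fun i => h2 i i.isLt, fun i => ⟨p i, hpJ i⟩, ?_, ?_⟩
    · funext i
      simp only [Function.comp_apply, tup]
      rw [((hExt_le (hJ i)).2 (p i) (hp i)).1, hpσ]
    · funext i
      simp only [Function.comp_apply, tup]
      rw [((hExt_le (hJ i)).2 (p i) (hp i)).2, hpg]

end BackAndForth

/-! ### Consequences of the axioms: closure transport and Haykazyan's Prop. 5 -/

namespace IsQuasiminimalPregeometryClass

variable {𝒞 : ∀ (H : Type u) [L.Structure H], (Set H → Set H) → Prop}
variable {H H' : Type u} [L.Structure H] [L.Structure H'] {cl : Set H → Set H}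
  {cl' : Set H' → Set H'}

/-- **Axiom (4i), combined form**: over a countable `G` which is closed with closed image, or
empty, points outside the closures correspond along `g`. [cite: Haykazyan2016, Definition 2] -/
theorem eqQFTypeOver₂_of_notMem_cl (h𝒞 : IsQuasiminimalPregeometryClass L 𝒞) (hH : 𝒞 H cl)
    (hH' : 𝒞 H' cl') (G : Set H) (g : H → H') (hGc : G.Countable)
    (hG : (cl G = G ∧ cl' (g '' G) = g '' G) ∨ G = ∅) (hg : IsPartialEmbOn L g G)
    {x : H} {x' : H'} (hx : x ∉ cl G) (hx' : x' ∉ cl' (g '' G)) :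
    L.EqQFTypeOver₂ G g ![x] ![x'] := by
  rcases hG with ⟨h1, h2⟩ | rfl
  · exact h𝒞.eqQFTypeOver₂_of_notMem_of_closed hH hH' G g hGc h1 h2 hg hx hx'
  · rw [image_empty] at hx'
    exact eqQFTypeOver₂_empty_iff.2 (h𝒞.eqQFType₂_of_notMem_cl_empty hH hH' hx hx')

/-- **Axiom (4ii), combined form**: over a countable `G` which is closed with closed image, or
empty, `g ∪ (x ↦ x')` extends over any point of `cl (G ∪ range x)`.
[cite: Haykazyan2016, Definition 2] -/
theorem exists_eqQFTypeOver₂_snoc (h𝒞 : IsQuasiminimalPregeometryClass L 𝒞) (hH : 𝒞 H cl)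
    (hH' : 𝒞 H' cl') (G : Set H) (g : H → H') (hGc : G.Countable)
    (hG : (cl G = G ∧ cl' (g '' G) = g '' G) ∨ G = ∅) {n : ℕ} (x : Fin n → H) (x' : Fin n → H')
    (hxx' : L.EqQFTypeOver₂ G g x x') {y : H} (hy : y ∈ cl (G ∪ range x)) :
    ∃ y' : H', L.EqQFTypeOver₂ G g (Fin.snoc x y : Fin (n + 1) → H) (Fin.snoc x' y') := by
  rcases hG with ⟨h1, h2⟩ | rfl
  · exact h𝒞.exists_eqQFTypeOver₂_snoc_of_closed hH hH' G g hGc h1 h2 x x' hxx' hy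
  · rw [empty_union] at hy
    obtain ⟨y', hy'⟩ := h𝒞.exists_eqQFType₂_snoc hH hH' x x' (eqQFTypeOver₂_empty_iff.1 hxx') hy
    exact ⟨y', eqQFTypeOver₂_empty_iff.2 hy'⟩

/-- In a class with an empty member, `cl ∅ = ∅` in every member ((4ii) over `∅` towards the empty
member). [folklore] -/
theorem cl_empty_eq_empty_of_isEmpty (h𝒞 : IsQuasiminimalPregeometryClass L 𝒞) (hH : 𝒞 H cl)
    (hH' : 𝒞 H' cl') [IsEmpty H] : cl' (∅ : Set H') = ∅ := by
  apply eq_empty_of_forall_notMem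
  intro b hb
  have h0 : L.EqQFType₂ (Fin.elim0 : Fin 0 → H') (Fin.elim0 : Fin 0 → H) :=
    (h𝒞.eqQFType₂_elim0 hH hH').symm
  have hb' : b ∈ cl' (range (Fin.elim0 : Fin 0 → H')) := by
    rwa [Set.range_eq_empty_iff.mpr (by infer_instance : IsEmpty (Fin 0))]
  obtain ⟨y', -⟩ := h𝒞.exists_eqQFType₂_snoc hH' hH _ _ h0 hb'
  exact isEmptyElim y'

/-- A finite matched pair of tuples `x ↦ x'` with `qftp(x) = qftp(x')` is (the graph of) a
partial embedding: some map `f` with `f ∘ x = x'` is a partial embedding on `range x`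
(coincidences among the `x i` are respected because equalities are atomic). [folklore] -/
theorem exists_fun_of_eqQFType₂ [Nonempty H'] {n : ℕ} {x : Fin n → H} {x' : Fin n → H'}
    (h : L.EqQFType₂ x x') : ∃ f : H → H', f ∘ x = x' ∧ IsPartialEmbOn L f (range x) := by
  classical
  let f : H → H' := fun z => if hz : ∃ i, x i = z then x' hz.choose else Classical.arbitrary H'
  have hf : ∀ i, f (x i) = x' i := by
    intro i
    have hz : ∃ j, x j = x i := ⟨i, rfl⟩
    simp only [f, dif_pos hz]
    exact h.eq_of_eq hz.choose_spec
  refine ⟨f, funext hf, fun m σ hσ => ?_⟩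
  choose ι hι using fun j => (hσ j)
  have e1 : σ = x ∘ ι := funext fun j => (hι j).symm
  have e2 : f ∘ σ = x' ∘ ι := funext fun j => by rw [Function.comp_apply, ← hι j, hf]; rfl
  rw [e2, e1]
  exact h.comp ι

/-- **The closure is determined by quantifier-free types of finite tuples** (Haykazyan's axiom
(3iii) in tuple form): if `qftp(b, a) = qftp(b', a')` across two members then
`a ∈ cl (range b) ↔ a' ∈ cl' (range b')`. [cite: Haykazyan2016, Definition 2] -/
theorem mem_cl_iff_of_eqQFType₂_snoc (h𝒞 : IsQuasiminimalPregeometryClass L 𝒞) (hH : 𝒞 H cl)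
    (hH' : 𝒞 H' cl') {n : ℕ} {b : Fin n → H} {b' : Fin n → H'} {a : H} {a' : H'}
    (h : L.EqQFType₂ (Fin.snoc b a : Fin (n + 1) → H) (Fin.snoc b' a')) :
    a ∈ cl (range b) ↔ a' ∈ cl' (range b') := by
  haveI : Nonempty H' := ⟨a'⟩
  obtain ⟨f, hf, hfemb⟩ := exists_fun_of_eqQFType₂ h
  have hfa : f a = a' := by simpa using congr_fun hf (Fin.last n)
  have hfb : ∀ i, f (b i) = b' i := fun i => by simpa using congr_fun hf (Fin.castSucc i)
  have hrange : range (Fin.snoc b a : Fin (n + 1) → H) = insert a (range b) := by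
    rw [Fin.range_snoc]
  rw [hrange] at hfemb
  have key := h𝒞.mem_cl_iff_of_isPartialEmbOn hH hH' (range b) a f hfemb
  have himg : f '' range b = range b' := by
    rw [← range_comp]
    exact congr_arg range (funext hfb)
  rwa [hfa, himg] at key

/-- **Transport of closure along `g ∪ (B, a) ↦ (B', b)`** (axiom (3iii) over a set): if
`qftp(G, B, a) = qftp(g[G], B', b)` and `a ∈ cl (G ∪ range B)` then `b ∈ cl' (g[G] ∪ range B')`.
[cite: Haykazyan2016, Definition 2] -/
theorem mem_cl_of_eqQFTypeOver₂_snoc (h𝒞 : IsQuasiminimalPregeometryClass L 𝒞) (hH : 𝒞 H cl)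
    (hH' : 𝒞 H' cl') {G : Set H} {g : H → H'} {n : ℕ} {B : Fin n → H} {B' : Fin n → H'} {a : H}
    {b : H'} (h : L.EqQFTypeOver₂ G g (Fin.snoc B a : Fin (n + 1) → H) (Fin.snoc B' b))
    (ha : a ∈ cl (G ∪ range B)) : b ∈ cl' (g '' G ∪ range B') := by
  have hP := h𝒞.isPregeometry hH
  have hP' := h𝒞.isPregeometry hH'
  obtain ⟨A₀, hA₀, hA₀fin, haA₀⟩ := hP.finite_character ha
  obtain ⟨m, σ, hσ⟩ := (hA₀fin.inter_of_left G).fin_embedding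
  have hσG : ∀ i, σ i ∈ G := fun i => ((hσ ▸ mem_range_self i : σ i ∈ A₀ ∩ G)).2
  have key := h σ hσG
  rw [Fin.append_snoc, Fin.append_snoc] at key
  have ha' : a ∈ cl (range (Fin.append (σ : Fin m → H) B)) := by
    refine hP.mono ?_ haA₀
    intro c hc
    rw [range_append]
    rcases hA₀ hc with hcG | hcB
    · exact Or.inl (hσ ▸ ⟨hc, hcG⟩ : c ∈ range σ)
    · exact Or.inr hcB
  have := (h𝒞.mem_cl_iff_of_eqQFType₂_snoc hH hH' key).1 ha'
  refine hP'.mono ?_ this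
  rw [range_append]
  refine union_subset_union_left _ ?_
  rintro _ ⟨i, rfl⟩
  exact ⟨σ i, hσG i, rfl⟩

/-- **Extension of `g ∪ f` to an isomorphism of closures** (Haykazyan 2016, Prop. 5 (1); the
successor step of Kirby 2010, Thm 2.1). Let `⟨H, cl⟩, ⟨H', cl'⟩ ∈ 𝒞`, `G ⊆ H` countable with
`G` and `g[G]` closed (or `G = ∅`), and `qftp(G, t) = qftp(g[G], t')` along `g` (i.e. `g ∪ (t ↦ t')`
is a partial embedding). Then there is a partial embedding `F` of `H` into `H'` on
`cl (G ∪ t)`, agreeing with `g` on `G`, sending `t ↦ t'`, with image exactly `cl' (g[G] ∪ t')` —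
an isomorphism `cl(G ∪ X) ≅ cl(G' ∪ X')` extending `g ∪ f`. Proof: countable back-and-forth
(`exists_map_of_backAndForth₂`) driven by axiom (4ii) on both sides.
[cite: Haykazyan2016, Proposition 5] -/
theorem exists_isPartialEmbOn_cl_extend (h𝒞 : IsQuasiminimalPregeometryClass L 𝒞) (hH : 𝒞 H cl)
    (hH' : 𝒞 H' cl') {G : Set H} {g : H → H'} (hGc : G.Countable)
    (hG : (cl G = G ∧ cl' (g '' G) = g '' G) ∨ G = ∅) {k : ℕ} {t : Fin k → H} {t' : Fin k → H'}
    (htt' : L.EqQFTypeOver₂ G g t t') :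
    ∃ F : H → H', IsPartialEmbOn L F (cl (G ∪ range t)) ∧ EqOn F g G ∧ (∀ i, F (t i) = t' i) ∧
      F '' cl (G ∪ range t) = cl' (g '' G ∪ range t') := by
  classical
  have hP := h𝒞.isPregeometry hH
  have hP' := h𝒞.isPregeometry hH'
  set C := cl (G ∪ range t) with hC
  set C' := cl' (g '' G ∪ range t') with hC'
  have hGC : G ⊆ C := subset_union_left.trans (hP.subset_cl _)
  have htC : ∀ i, t i ∈ C := fun i => hP.subset_cl _ (Or.inr (mem_range_self i))
  have hfGC' : g '' G ⊆ C' := subset_union_left.trans (hP'.subset_cl _)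
  have ht'C' : ∀ i, t' i ∈ C' := fun i => hP'.subset_cl _ (Or.inr (mem_range_self i))
  have hCcl : cl C = C := hP.cl_cl _
  have hC'cl : cl' C' = C' := hP'.cl_cl _
  have hgG : IsPartialEmbOn L g G := htt'.isPartialEmbOn
  haveI : Nonempty (H → H') := ⟨g⟩
  -- the degenerate case of an empty structure `H`
  rcases isEmpty_or_nonempty H with hM | hM
  · refine ⟨g, fun n x _ => ?_, fun a _ => rfl, fun i => isEmptyElim (t i), ?_⟩
    · rcases Nat.eq_zero_or_pos n with rfl | hn
      · have ex : x = Fin.elim0 := funext fun i => i.elim0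
        subst ex
        have e1 : g ∘ (Fin.elim0 : Fin 0 → H) = Fin.elim0 := funext fun i => i.elim0
        rw [e1]
        exact h𝒞.eqQFType₂_elim0 hH hH'
      · exact isEmptyElim (x ⟨0, hn⟩)
    · have hk : k = 0 := by
        rcases Nat.eq_zero_or_pos k with h | h
        · exact h
        · exact isEmptyElim (t ⟨0, h⟩)
      subst hk
      have ht' : range t' = ∅ := Set.range_eq_empty_iff.mpr (by infer_instance)
      rw [eq_empty_of_isEmpty C, image_empty, hC', eq_empty_of_isEmpty G, image_empty, empty_union,
        ht', h𝒞.cl_empty_eq_empty_of_isEmpty hH hH']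
  -- an inverse of `g` on `G`
  set g' := Function.invFunOn g G with hg'def
  have hg' : ∀ a ∈ G, g' (g a) = a := fun a ha => hgG.injOn.leftInvOn_invFunOn ha
  have hg'G : g' '' (g '' G) = G := LeftInvOn.image_image hg'
  have hG' : (cl' (g '' G) = g '' G ∧ cl (g' '' (g '' G)) = g' '' (g '' G)) ∨ g '' G = ∅ := by
    rcases hG with ⟨h1, h2⟩ | h
    · exact Or.inl ⟨h2, by rw [hg'G]; exact h1⟩
    · exact Or.inr (by rw [h, image_empty])
  have hgg' : ∀ b ∈ g '' G, g (g' b) = b := fun b hb => LeftInvOn.rightInvOn_image hg' hb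
  -- the back-and-forth relation
  let S : ∀ n : ℕ, (Fin n → H) → (Fin n → H') → Prop := fun n x y =>
    L.EqQFTypeOver₂ G g (Fin.append t x) (Fin.append t' y)
  have h0 : S 0 Fin.elim0 Fin.elim0 := htt'.append_elim0
  have hwd : ∀ ⦃n⦄ ⦃x : Fin n → H⦄ ⦃y : Fin n → H'⦄, S n x y → ∀ i j, x i = x j ↔ y i = y j :=
    fun n x y hS i j => hS.eqQFType₂.append_right.apply_eq_iff i j
  have forth : ∀ ⦃n⦄ ⦃x : Fin n → H⦄ ⦃y : Fin n → H'⦄, S n x y → (∀ i, x i ∈ C) → (∀ i, y i ∈ C') →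
      ∀ a ∈ C, ∃ b ∈ C', S (n + 1) (Fin.snoc x a) (Fin.snoc y b) := by
    intro n x y hS hx hy a ha
    have ha' : a ∈ cl (G ∪ range (Fin.append t x)) := by
      refine hP.mono ?_ ha
      rw [range_append]
      exact union_subset_union_right _ subset_union_left
    obtain ⟨b, hb⟩ := h𝒞.exists_eqQFTypeOver₂_snoc hH hH' G g hGc hG _ _ hS ha'
    refine ⟨b, ?_, ?_⟩
    · have := h𝒞.mem_cl_of_eqQFTypeOver₂_snoc hH hH' hb ha'
      rw [← hC'cl]
      refine hP'.mono ?_ this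
      rw [range_append]
      refine union_subset hfGC' (union_subset ?_ ?_)
      · rintro _ ⟨i, rfl⟩; exact ht'C' i
      · rintro _ ⟨i, rfl⟩; exact hy i
    · change L.EqQFTypeOver₂ G g (Fin.append t (Fin.snoc x a)) (Fin.append t' (Fin.snoc y b))
      rwa [Fin.append_snoc, Fin.append_snoc]
  have back : ∀ ⦃n⦄ ⦃x : Fin n → H⦄ ⦃y : Fin n → H'⦄, S n x y → (∀ i, x i ∈ C) → (∀ i, y i ∈ C') →
      ∀ b ∈ C', ∃ a ∈ C, S (n + 1) (Fin.snoc x a) (Fin.snoc y b) := by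
    intro n x y hS hx hy b hb
    have hS' : L.EqQFTypeOver₂ (g '' G) g' (Fin.append t' y) (Fin.append t x) :=
      hS.symm_of_inverse hg'
    have hb' : b ∈ cl' (g '' G ∪ range (Fin.append t' y)) := by
      refine hP'.mono ?_ hb
      rw [range_append]
      exact union_subset_union_right _ subset_union_left
    obtain ⟨a, ha⟩ := h𝒞.exists_eqQFTypeOver₂_snoc hH' hH (g '' G) g' (hGc.image g) hG' _ _ hS' hb'
    refine ⟨a, ?_, ?_⟩
    · have := h𝒞.mem_cl_of_eqQFTypeOver₂_snoc hH' hH ha hb'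
      rw [hg'G] at this
      rw [← hCcl]
      refine hP.mono ?_ this
      rw [range_append]
      refine union_subset hGC (union_subset ?_ ?_)
      · rintro _ ⟨i, rfl⟩; exact htC i
      · rintro _ ⟨i, rfl⟩; exact hx i
    · have := ha.symm_of_inverse hgg'
      rw [hg'G] at this
      change L.EqQFTypeOver₂ G g (Fin.append t (Fin.snoc x a)) (Fin.append t' (Fin.snoc y b))
      rwa [Fin.append_snoc, Fin.append_snoc]
  obtain ⟨F, hFC, hcov⟩ := exists_map_of_backAndForth₂
    (hP.countable_cl (h𝒞.countable_cl hH) (hGc.union (countable_range t)))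
    (hP'.countable_cl (h𝒞.countable_cl hH') ((hGc.image g).union (countable_range t')))
    h0 hwd forth back
  refine ⟨F, ?_, ?_, ?_, hFC⟩
  · intro m σ hσ
    obtain ⟨n, x, y, hS, -, -, ι, hx, hy⟩ := hcov σ hσ
    have := (hS.eqQFType₂.append_right).comp ι
    rwa [hx, hy] at this
  · intro a ha
    obtain ⟨n, x, y, hS, -, -, ι, hx, hy⟩ := hcov ![a] (fun i => by simpa using hGC ha)
    have h1 : a = Fin.append t x (Fin.natAdd k (ι 0)) := by
      simp only [Fin.append_right]
      exact (congr_fun hx 0).symm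
    have h2 := hS.apply_eq_of_mem ha h1
    rw [Fin.append_right] at h2
    have h3 : y (ι 0) = F a := by simpa using congr_fun hy 0
    rw [h2, h3]
  · intro i
    obtain ⟨n, x, y, hS, -, -, ι, hx, hy⟩ := hcov ![t i] (fun j => by simpa using htC i)
    have h1 : Fin.append t x (Fin.castAdd n i) = Fin.append t x (Fin.natAdd k (ι 0)) := by
      simp only [Fin.append_left, Fin.append_right]
      exact (congr_fun hx 0).symm
    have h2 := hS.eqQFType₂.eq_of_eq h1
    simp only [Fin.append_left, Fin.append_right] at h2
    have h3 : y (ι 0) = F (t i) := by simpa using congr_fun hy 0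
    rw [h2, h3]

/-- **Generic one-point extensions, with seeds** (Haykazyan 2016, Prop. 5 (2); Kirby 2010, axiom
II.1 over the closed set `cl (G ∪ X)`): with `G`, `g`, `t`, `t'` as in
`exists_isPartialEmbOn_cl_extend`, points `a ∉ cl (G ∪ t)`, `a' ∉ cl' (g[G] ∪ t')` can be matched:
`qftp(G, t, a) = qftp(g[G], t', a')`. [cite: Haykazyan2016, Proposition 5] -/
theorem eqQFTypeOver₂_snoc_of_notMem_cl (h𝒞 : IsQuasiminimalPregeometryClass L 𝒞) (hH : 𝒞 H cl)
    (hH' : 𝒞 H' cl') {G : Set H} {g : H → H'} (hGc : G.Countable)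
    (hG : (cl G = G ∧ cl' (g '' G) = g '' G) ∨ G = ∅) {k : ℕ} {t : Fin k → H} {t' : Fin k → H'}
    (htt' : L.EqQFTypeOver₂ G g t t') {a : H} {a' : H'} (ha : a ∉ cl (G ∪ range t))
    (ha' : a' ∉ cl' (g '' G ∪ range t')) :
    L.EqQFTypeOver₂ G g (Fin.snoc t a : Fin (k + 1) → H) (Fin.snoc t' a') := by
  have hP := h𝒞.isPregeometry hH
  have hP' := h𝒞.isPregeometry hH'
  obtain ⟨F, hF, hFf, hFt, hFim⟩ := h𝒞.exists_isPartialEmbOn_cl_extend hH hH' hGc hG htt'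
  set C := cl (G ∪ range t) with hC
  have hCcl : cl C = C := hP.cl_cl _
  have hFCcl : cl' (F '' C) = F '' C := by rw [hFim]; exact hP'.cl_cl _
  have ha'' : a' ∉ cl' (F '' C) := by rwa [hFCcl, hFim]
  have haC : a ∉ cl C := by rwa [hCcl]
  have key := h𝒞.eqQFTypeOver₂_of_notMem_cl hH hH' C F
    (hP.countable_cl (h𝒞.countable_cl hH) (hGc.union (countable_range t))) (Or.inl ⟨hCcl, hFCcl⟩)
    hF haC ha''
  intro m σ hσ
  have hσt : ∀ i, Fin.append σ t i ∈ C := fun i => by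
    refine Fin.addCases (fun j => ?_) (fun j => ?_) i
    · simpa using subset_union_left.trans (hP.subset_cl _) (hσ j)
    · simpa using hP.subset_cl _ (Or.inr (mem_range_self j) : t j ∈ G ∪ range t)
  have := key (Fin.append σ t) hσt
  have e1 : F ∘ Fin.append σ t = Fin.append (g ∘ σ) t' := by
    funext i
    refine Fin.addCases (fun j => ?_) (fun j => ?_) i
    · simpa using hFf (hσ j)
    · simpa using hFt j
  rw [e1, Fin.append_right_eq_snoc, Fin.append_right_eq_snoc, Matrix.cons_val_fin_one,
    Matrix.cons_val_fin_one, ← Fin.append_snoc, ← Fin.append_snoc] at this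
  exact this

end IsQuasiminimalPregeometryClass

end Literature.ModelTheory.Quasiminimal

end
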